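import Mathlib
import Summits.Ventures.PercRepro2.TypedSeparatedSides

/-!
# The separated class of row 2′TRI, III: the placements with a constant root status vanish
(blind cell PercRepro2, night-3 g5, 2026-08-25; `proofs/NIGHT3-CERT.md` §14.8)

If the component of `a₂` in `z ∪ F` contains none of `a₁, o, b, a₃`, then on the support every
copy has the same `(q′, H_o, H_b, H₃)`-part `(false, false, false, false)` and the symmetrised
kernel vanishes (`KBsym_eq_zero_of_H`): `typedCount F z τ K₃ = 0`
(`typedCount_eq_zero_of_hComponent_free`); mirror for `a₁` (`…_lComponent_free`).  On the
separated class this settles the placements «`o, b, a₃` all on one side» and «`a₃` on neither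
side» (paper §14.4, cases (i)); the remaining placement «`o` and `b` on different sides» is
paper only.
-/

namespace Summit.Ventures.PercRepro2

open UnionCluster

namespace CovForm

namespace Separated

open OneTyped TypedA3 Untouched TypedFactor

section Main

open Classical

variable {V : Type*} {E : Type*} [Fintype E] [DecidableEq E] {R : Type*} [Field R]
  [LinearOrder R] [IsStrictOrderedRing R]
variable (ends : E → Sym2 V) (o a₁ a₂ a₃ b : V)

omit [Fintype E] in
/-- If the `z ∪ F`-component of `a₂` avoids `a₁, o, b, a₃`, every copy of the support has the
trivial `(q′, H)`-part. -/
lemma st_eq_of_hFree (F : Finset E) (z : Config E)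
    (h1 : ¬ Conn ends (zF F z) a₂ a₁) (ho : ¬ Conn ends (zF F z) a₂ o)
    (hb : ¬ Conn ends (zF F z) a₂ b) (h3 : ¬ Conn ends (zF F z) a₂ a₃)
    {x : Config E} (hx : ∀ e, e ∉ F → x e = z e) :
    st ends o a₁ a₂ a₃ b x =
      mkSt false (decide (Conn ends x a₁ o)) (decide (Conn ends x a₁ b))
        (decide (Conn ends x a₁ a₃)) false false false := by
  have hle : x ≤ zF F z := le_zF hx
  have c1 : ¬ Conn ends x a₂ a₁ := fun h => h1 (conn_mono hle h)
  have co : ¬ Conn ends x a₂ o := fun h => ho (conn_mono hle h)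
  have cb : ¬ Conn ends x a₂ b := fun h => hb (conn_mono hle h)
  have c3 : ¬ Conn ends x a₂ a₃ := fun h => h3 (conn_mono hle h)
  unfold st mkSt
  simp only [c1, co, cb, c3, decide_false]

omit [Fintype E] in
/-- Mirror: the `z ∪ F`-component of `a₁` avoids `a₂, o, b, a₃`. -/
lemma st_eq_of_lFree (F : Finset E) (z : Config E)
    (h2 : ¬ Conn ends (zF F z) a₂ a₁) (ho : ¬ Conn ends (zF F z) a₁ o)
    (hb : ¬ Conn ends (zF F z) a₁ b) (h3 : ¬ Conn ends (zF F z) a₁ a₃)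
    {x : Config E} (hx : ∀ e, e ∉ F → x e = z e) :
    st ends o a₁ a₂ a₃ b x =
      mkSt false false false false (decide (Conn ends x a₂ o)) (decide (Conn ends x a₂ b))
        (decide (Conn ends x a₂ a₃)) := by
  have hle : x ≤ zF F z := le_zF hx
  have c1 : ¬ Conn ends x a₂ a₁ := fun h => h2 (conn_mono hle h)
  have co : ¬ Conn ends x a₁ o := fun h => ho (conn_mono hle h)
  have cb : ¬ Conn ends x a₁ b := fun h => hb (conn_mono hle h)
  have c3 : ¬ Conn ends x a₁ a₃ := fun h => h3 (conn_mono hle h)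
  unfold st mkSt
  simp only [c1, co, cb, c3, decide_false]

/-- **Vanishing when the `h`-component is mark-free**: if the component of `a₂` in `z ∪ F`
contains none of `a₁, o, b, a₃`, the typed base is `0`. -/
theorem typedCount_eq_zero_of_hComponent_free (F : Finset E) (z : Config E) (τ : E → ℕ)
    (hτ : ∀ e ∈ F, τ e = 1 ∨ τ e = 2)
    (h1 : ¬ Conn ends (zF F z) a₂ a₁) (ho : ¬ Conn ends (zF F z) a₂ o)
    (hb : ¬ Conn ends (zF F z) a₂ b) (h3 : ¬ Conn ends (zF F z) a₂ a₃) :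
    typedCount F z τ (K3 ends o a₁ a₂ a₃ b : Config E → Config E → Config E → R) = 0 := by
  have h6 := six_mul_typedCount F z τ hτ (K3 ends o a₁ a₂ a₃ b : Config E → Config E → Config E → R)
  have hzero : typedCount F z τ (fun x y w : Config E =>
      (K3 ends o a₁ a₂ a₃ b x y w : R) + K3 ends o a₁ a₂ a₃ b x w y + K3 ends o a₁ a₂ a₃ b y x w +
        K3 ends o a₁ a₂ a₃ b y w x + K3 ends o a₁ a₂ a₃ b w x y + K3 ends o a₁ a₂ a₃ b w y x) =
      typedCount F z τ (fun _ _ _ => (0 : R)) := by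
    refine typedCount_congr_on_support F z τ fun x y w hxyw _ => ?_
    have hx : ∀ e, e ∉ F → x e = z e := fun e he => (hxyw e he).1
    have hy : ∀ e, e ∉ F → y e = z e := fun e he => (hxyw e he).2.1
    have hw : ∀ e, e ∉ F → w e = z e := fun e he => (hxyw e he).2.2
    simp only [K3_eq_KB ends o a₁ a₂ a₃ b, st_eq_of_hFree ends o a₁ a₂ a₃ b F z h1 ho hb h3 hx,
      st_eq_of_hFree ends o a₁ a₂ a₃ b F z h1 ho hb h3 hy,
      st_eq_of_hFree ends o a₁ a₂ a₃ b F z h1 ho hb h3 hw]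
    have := KBsym_eq_zero_of_H false false false false
      (decide (Conn ends x a₁ o)) (decide (Conn ends x a₁ b)) (decide (Conn ends x a₁ a₃))
      (decide (Conn ends y a₁ o)) (decide (Conn ends y a₁ b)) (decide (Conn ends y a₁ a₃))
      (decide (Conn ends w a₁ o)) (decide (Conn ends w a₁ b)) (decide (Conn ends w a₁ a₃))
    unfold KBsym at this
    exact_mod_cast this
  rw [hzero, typedCount_zero_kernel] at h6
  have h6' : (6 : R) ≠ 0 := by norm_num
  exact (mul_eq_zero.mp h6).resolve_left h6'

/-- **Vanishing when the `l`-component is mark-free**: the mirror statement. -/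
theorem typedCount_eq_zero_of_lComponent_free (F : Finset E) (z : Config E) (τ : E → ℕ)
    (hτ : ∀ e ∈ F, τ e = 1 ∨ τ e = 2)
    (h2 : ¬ Conn ends (zF F z) a₂ a₁) (ho : ¬ Conn ends (zF F z) a₁ o)
    (hb : ¬ Conn ends (zF F z) a₁ b) (h3 : ¬ Conn ends (zF F z) a₁ a₃) :
    typedCount F z τ (K3 ends o a₁ a₂ a₃ b : Config E → Config E → Config E → R) = 0 := by
  have h6 := six_mul_typedCount F z τ hτ (K3 ends o a₁ a₂ a₃ b : Config E → Config E → Config E → R)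
  have hzero : typedCount F z τ (fun x y w : Config E =>
      (K3 ends o a₁ a₂ a₃ b x y w : R) + K3 ends o a₁ a₂ a₃ b x w y + K3 ends o a₁ a₂ a₃ b y x w +
        K3 ends o a₁ a₂ a₃ b y w x + K3 ends o a₁ a₂ a₃ b w x y + K3 ends o a₁ a₂ a₃ b w y x) =
      typedCount F z τ (fun _ _ _ => (0 : R)) := by
    refine typedCount_congr_on_support F z τ fun x y w hxyw _ => ?_
    have hx : ∀ e, e ∉ F → x e = z e := fun e he => (hxyw e he).1
    have hy : ∀ e, e ∉ F → y e = z e := fun e he => (hxyw e he).2.1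
    have hw : ∀ e, e ∉ F → w e = z e := fun e he => (hxyw e he).2.2
    simp only [K3_eq_KB ends o a₁ a₂ a₃ b, st_eq_of_lFree ends o a₁ a₂ a₃ b F z h2 ho hb h3 hx,
      st_eq_of_lFree ends o a₁ a₂ a₃ b F z h2 ho hb h3 hy,
      st_eq_of_lFree ends o a₁ a₂ a₃ b F z h2 ho hb h3 hw]
    have := KBsym_eq_zero_of_L false false false false
      (decide (Conn ends x a₂ o)) (decide (Conn ends x a₂ b)) (decide (Conn ends x a₂ a₃))
      (decide (Conn ends y a₂ o)) (decide (Conn ends y a₂ b)) (decide (Conn ends y a₂ a₃))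
      (decide (Conn ends w a₂ o)) (decide (Conn ends w a₂ b)) (decide (Conn ends w a₂ a₃))
    unfold KBsym at this
    exact_mod_cast this
  rw [hzero, typedCount_zero_kernel] at h6
  have h6' : (6 : R) ≠ 0 := by norm_num
  exact (mul_eq_zero.mp h6).resolve_left h6'

/-- On a separated instance with `o, b, a₃` all on the `l`-side the typed base is `0`. -/
theorem typedCount_eq_zero_of_sep_allL (F : Finset E) (z : Config E) (τ : E → ℕ)
    (hτ : ∀ e ∈ F, τ e = 1 ∨ τ e = 2) (hsep : Sep ends a₁ a₂ F z)
    (ho : o ∈ cluster ends (zF F z) a₁) (hb : b ∈ cluster ends (zF F z) a₁)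
    (h3 : a₃ ∈ cluster ends (zF F z) a₁) :
    typedCount F z τ (K3 ends o a₁ a₂ a₃ b : Config E → Config E → Config E → R) = 0 := by
  rw [mem_cluster] at ho hb h3
  refine typedCount_eq_zero_of_hComponent_free ends o a₁ a₂ a₃ b F z τ hτ hsep ?_ ?_ ?_
  · exact fun h => hsep (conn_trans h (conn_symm ho))
  · exact fun h => hsep (conn_trans h (conn_symm hb))
  · exact fun h => hsep (conn_trans h (conn_symm h3))

/-- On a separated instance with `o, b` on the `l`-side and `a₃` off the `h`-side the typed base
is `0`. -/
theorem typedCount_eq_zero_of_sep_a3_offH (F : Finset E) (z : Config E) (τ : E → ℕ)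
    (hτ : ∀ e ∈ F, τ e = 1 ∨ τ e = 2) (hsep : Sep ends a₁ a₂ F z)
    (ho : o ∈ cluster ends (zF F z) a₁) (hb : b ∈ cluster ends (zF F z) a₁)
    (h3 : a₃ ∉ cluster ends (zF F z) a₂) :
    typedCount F z τ (K3 ends o a₁ a₂ a₃ b : Config E → Config E → Config E → R) = 0 := by
  rw [mem_cluster] at ho hb h3
  refine typedCount_eq_zero_of_hComponent_free ends o a₁ a₂ a₃ b F z τ hτ hsep ?_ ?_ h3
  · exact fun h => hsep (conn_trans h (conn_symm ho))
  · exact fun h => hsep (conn_trans h (conn_symm hb))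

omit [Fintype E] in
/-- If `o` is connected to neither root in `z ∪ F`, every copy of the support has the trivial
`o`-status. -/
lemma st_eq_of_oFree (F : Finset E) (z : Config E)
    (h1 : ¬ Conn ends (zF F z) a₁ o) (h2 : ¬ Conn ends (zF F z) a₂ o)
    {x : Config E} (hx : ∀ e, e ∉ F → x e = z e) :
    st ends o a₁ a₂ a₃ b x =
      mkSt (decide (Conn ends x a₂ a₁)) false (decide (Conn ends x a₁ b))
        (decide (Conn ends x a₁ a₃)) false (decide (Conn ends x a₂ b))
        (decide (Conn ends x a₂ a₃)) := by
  have hle : x ≤ zF F z := le_zF hx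
  have c1 : ¬ Conn ends x a₁ o := fun h => h1 (conn_mono hle h)
  have c2 : ¬ Conn ends x a₂ o := fun h => h2 (conn_mono hle h)
  unfold st mkSt
  simp only [c1, c2, decide_false]

omit [Fintype E] in
/-- If `b` is connected to neither root in `z ∪ F`, every copy of the support has the trivial
`b`-status. -/
lemma st_eq_of_bFree (F : Finset E) (z : Config E)
    (h1 : ¬ Conn ends (zF F z) a₁ b) (h2 : ¬ Conn ends (zF F z) a₂ b)
    {x : Config E} (hx : ∀ e, e ∉ F → x e = z e) :
    st ends o a₁ a₂ a₃ b x =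
      mkSt (decide (Conn ends x a₂ a₁)) (decide (Conn ends x a₁ o)) false
        (decide (Conn ends x a₁ a₃)) (decide (Conn ends x a₂ o)) false
        (decide (Conn ends x a₂ a₃)) := by
  have hle : x ≤ zF F z := le_zF hx
  have c1 : ¬ Conn ends x a₁ b := fun h => h1 (conn_mono hle h)
  have c2 : ¬ Conn ends x a₂ b := fun h => h2 (conn_mono hle h)
  unfold st mkSt
  simp only [c1, c2, decide_false]

/-- **Vanishing when `o` reaches no root in `z ∪ F`.** -/
theorem typedCount_eq_zero_of_oFree (F : Finset E) (z : Config E) (τ : E → ℕ)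
    (hτ : ∀ e ∈ F, τ e = 1 ∨ τ e = 2)
    (h1 : ¬ Conn ends (zF F z) a₁ o) (h2 : ¬ Conn ends (zF F z) a₂ o) :
    typedCount F z τ (K3 ends o a₁ a₂ a₃ b : Config E → Config E → Config E → R) = 0 := by
  have h6 := six_mul_typedCount F z τ hτ (K3 ends o a₁ a₂ a₃ b : Config E → Config E → Config E → R)
  have hzero : typedCount F z τ (fun x y w : Config E =>
      (K3 ends o a₁ a₂ a₃ b x y w : R) + K3 ends o a₁ a₂ a₃ b x w y + K3 ends o a₁ a₂ a₃ b y x w +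
        K3 ends o a₁ a₂ a₃ b y w x + K3 ends o a₁ a₂ a₃ b w x y + K3 ends o a₁ a₂ a₃ b w y x) =
      typedCount F z τ (fun _ _ _ => (0 : R)) := by
    refine typedCount_congr_on_support F z τ fun x y w hxyw _ => ?_
    have hx : ∀ e, e ∉ F → x e = z e := fun e he => (hxyw e he).1
    have hy : ∀ e, e ∉ F → y e = z e := fun e he => (hxyw e he).2.1
    have hw : ∀ e, e ∉ F → w e = z e := fun e he => (hxyw e he).2.2
    simp only [K3_eq_KB ends o a₁ a₂ a₃ b, st_eq_of_oFree ends o a₁ a₂ a₃ b F z h1 h2 hx,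
      st_eq_of_oFree ends o a₁ a₂ a₃ b F z h1 h2 hy, st_eq_of_oFree ends o a₁ a₂ a₃ b F z h1 h2 hw]
    have := KBsym_eq_zero_of_o (decide (Conn ends x a₂ a₁)) (decide (Conn ends y a₂ a₁))
      (decide (Conn ends w a₂ a₁)) false false
      (decide (Conn ends x a₁ b)) (decide (Conn ends x a₁ a₃)) (decide (Conn ends x a₂ b))
      (decide (Conn ends x a₂ a₃))
      (decide (Conn ends y a₁ b)) (decide (Conn ends y a₁ a₃)) (decide (Conn ends y a₂ b))
      (decide (Conn ends y a₂ a₃))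
      (decide (Conn ends w a₁ b)) (decide (Conn ends w a₁ a₃)) (decide (Conn ends w a₂ b))
      (decide (Conn ends w a₂ a₃))
    unfold KBsym at this
    exact_mod_cast this
  rw [hzero, typedCount_zero_kernel] at h6
  have h6' : (6 : R) ≠ 0 := by norm_num
  exact (mul_eq_zero.mp h6).resolve_left h6'

/-- **Vanishing when `b` reaches no root in `z ∪ F`.** -/
theorem typedCount_eq_zero_of_bFree (F : Finset E) (z : Config E) (τ : E → ℕ)
    (hτ : ∀ e ∈ F, τ e = 1 ∨ τ e = 2)
    (h1 : ¬ Conn ends (zF F z) a₁ b) (h2 : ¬ Conn ends (zF F z) a₂ b) :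
    typedCount F z τ (K3 ends o a₁ a₂ a₃ b : Config E → Config E → Config E → R) = 0 := by
  have h6 := six_mul_typedCount F z τ hτ (K3 ends o a₁ a₂ a₃ b : Config E → Config E → Config E → R)
  have hzero : typedCount F z τ (fun x y w : Config E =>
      (K3 ends o a₁ a₂ a₃ b x y w : R) + K3 ends o a₁ a₂ a₃ b x w y + K3 ends o a₁ a₂ a₃ b y x w +
        K3 ends o a₁ a₂ a₃ b y w x + K3 ends o a₁ a₂ a₃ b w x y + K3 ends o a₁ a₂ a₃ b w y x) =
      typedCount F z τ (fun _ _ _ => (0 : R)) := by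
    refine typedCount_congr_on_support F z τ fun x y w hxyw _ => ?_
    have hx : ∀ e, e ∉ F → x e = z e := fun e he => (hxyw e he).1
    have hy : ∀ e, e ∉ F → y e = z e := fun e he => (hxyw e he).2.1
    have hw : ∀ e, e ∉ F → w e = z e := fun e he => (hxyw e he).2.2
    simp only [K3_eq_KB ends o a₁ a₂ a₃ b, st_eq_of_bFree ends o a₁ a₂ a₃ b F z h1 h2 hx,
      st_eq_of_bFree ends o a₁ a₂ a₃ b F z h1 h2 hy, st_eq_of_bFree ends o a₁ a₂ a₃ b F z h1 h2 hw]
    have := KBsym_eq_zero_of_b (decide (Conn ends x a₂ a₁)) (decide (Conn ends y a₂ a₁))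
      (decide (Conn ends w a₂ a₁)) false false
      (decide (Conn ends x a₁ o)) (decide (Conn ends x a₁ a₃)) (decide (Conn ends x a₂ o))
      (decide (Conn ends x a₂ a₃))
      (decide (Conn ends y a₁ o)) (decide (Conn ends y a₁ a₃)) (decide (Conn ends y a₂ o))
      (decide (Conn ends y a₂ a₃))
      (decide (Conn ends w a₁ o)) (decide (Conn ends w a₁ a₃)) (decide (Conn ends w a₂ o))
      (decide (Conn ends w a₂ a₃))
    unfold KBsym at this
    exact_mod_cast this
  rw [hzero, typedCount_zero_kernel] at h6
  have h6' : (6 : R) ≠ 0 := by norm_num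
  exact (mul_eq_zero.mp h6).resolve_left h6'

end Main

end Separated

end CovForm

end Summit.Ventures.PercRepro2
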